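import Summits.ResolutionOfSingularities.ResolutionOfSingularities.Theorems.HilbertSamuelEliminationSigmaMaxModificationsCorridor3CPFrameFaceVertexAny
import Summits.ResolutionOfSingularities.ResolutionOfSingularities.Theorems.HilbertSamuelEliminationSigmaMaxModificationsCorridor3CPFramePropagationMenuChainChar
import HarnessLib

/-!
# [OURS · L1 W4.2] D18 `hread_menu` UNCONDITIONAL IN ALL CODIMENSIONS: the face reading from FULL minimality (no projection fact), the menu
# reading of permissible faces of any dimension, and the E-adapted chain with `hread_menu` discharged modulo the initial frame and the face constraint
# (cell res-hironaka, LADDER-RESOLUTION rung L; slot W4.2, crux chain w42 `SigmaMaxModificationsCorridor3` stmt-ResolutionOfSingularities-19249;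
# `--supports stmt-ResolutionOfSingularities-19249 --as helper`; hand res-D-brk-3 (gen 7), file F1e/F3e — supersedes the NEED-FACT of 18:25:05Z)

0 `def`s, every declaration PROVED; OURS bookkeeping; NOT a statement of Hironaka's manuscript [Hironaka2017] nor of [CossartPiltant2019]/[CossartJannsenSaito2020].
AI-written, weaker than expert review.

* **`eq_span_and_coeff_mem_pow_of_isMinimal_any`** — THE FACE READING for ANY `T` from `IsMinimal u h` (full polyhedron) over an equicharacteristic
  regular local base: `𝔔 ∩ R = (u_T)`, `s·h ∈ 𝔔^m`, `s ∉ 𝔔` ⟹ `𝔔 = (u_T)·R[X] + (X)` and legality (p557353's argument with the projected-minimality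
  hypothesis replaced by `mem_span_image_of_isMinimal_of_coeff_sub_mem`).
* **`IsCPFrame.exists_reading_of_face`** — a PERMISSIBLE face-centre (`ū_t ∈ 𝓘_C·B` for `t ∈ T`, `dim 𝒪/𝓘_C + |T| = 3`) of a CP frame with
  `δ ≥ 1` over equicharacteristic stalks is read as `V(X, u_T)` legally — points, member curves AND member surfaces.
* **`exists_isCPFrame_adapted_of_reachesσE_of_faces''`** — E-adapted complete minimal CP frames with `δ ≥ 1` along
  `ReachesσE (Strategy.cjs R₀).withBoundary 3 ν ⟨init, E₀⟩`, given ONLY the initial E₀-adapted frame and the face constraint on the canonical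
  centres at the marked points (no projection fact, no characteristic binder).

References: CP 2019 = arXiv:1412.0868v1, Prop. 2.3–2.4, Def. 2.6–2.7, Prop. 2.7 (pp. 11–14) [CossartPiltant2019]; CJS LNM 2270 Def. 3.1, Rem. 6.29 (1)
[CossartJannsenSaito2020].
-/

noncomputable section

set_option linter.dupNamespace false

open CategoryTheory AlgebraicGeometry TopologicalSpace IsLocalRing Polynomial Finset
open Literature.AlgebraicGeometry.Resolution Literature.AlgebraicGeometry.Resolution.CossartPiltant Literature.RingTheory.HilbertSamuel
open Summit.ResolutionOfSingularities.ResolutionOfSingularities.Theorems.CampaignW42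
open Summit.ResolutionOfSingularities.ResolutionOfSingularities.Theorems.SigmaMaxModificationsCorridor3.Sigma

universe u

namespace Summit.ResolutionOfSingularities.ResolutionOfSingularities.Theorems.SigmaMaxModificationsCorridor3.Helpers

variable {R : Type u} [CommRing R] [IsRegularLocalRing R]

/-- [OURS · L1 W4.2] **THE FACE READING in any codimension from FULL minimality.** See the module docstring.
[cite: CossartPiltant2019, Prop. 2.3–2.4 and proof of Prop. 2.7 (arXiv v1 pp. 11–14)] [cite: Matsumura1987, Thm. 16.2 (ii), Thm. 19.4] -/
theorem eq_span_and_coeff_mem_pow_of_isMinimal_any (hchar : ∀ k : ℕ, (k : R) ≠ 0 → IsUnit (k : R))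
    {n : ℕ} (hdim : ringKrullDim R = n) (u : Fin n → R) (hu : Ideal.span (Set.range u) = maximalIdeal R)
    {h : R[X]} (hmo : h.Monic) (hm : 0 < h.natDegree) (hmin : IsMinimal u h) (T : Finset (Fin n))
    (𝔔 : Ideal R[X]) [h𝔔p : 𝔔.IsPrime] (h𝔔 : 𝔔.comap (C : R →+* R[X]) = Ideal.span (u '' ↑T))
    (hord : ∃ s ∉ 𝔔, s * h ∈ 𝔔 ^ h.natDegree) :
    𝔔 = (Ideal.span (u '' ↑T)).map (C : R →+* R[X]) ⊔ Ideal.span {X} ∧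
      ∀ i ∈ Finset.Icc 1 h.natDegree, h.coeff (h.natDegree - i) ∈ Ideal.span (u '' ↑T) ^ i := by
  classical
  set m := h.natDegree with hmdef
  -- the sub-family `z = u|_T`
  set z : Fin T.card → R := u ∘ (fun i => T.orderEmbOfFin rfl i) with hz
  have hzr : Set.range z = u '' ↑T := by
    rw [hz, Set.range_comp]
    exact congrArg _ (Finset.range_orderEmbOfFin T rfl)
  rw [← hzr] at h𝔔 ⊢
  set 𝔭 := Ideal.span (Set.range z) with h𝔭
  -- `u` is an r.s.p., `z` part of one
  have hd : (maximalIdeal R).spanFinrank = n := by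
    have h1 := IsRegularLocalRing.spanFinrank_maximalIdeal (R := R)
    rw [hdim] at h1
    exact_mod_cast h1
  have hzu : IsRsopPart u := ⟨‹_›, 0, Fin.elim0, by rw [hdim, Nat.add_zero], by
    rw [← hu]; congr 1; ext x; simp⟩
  have hzT : IsRsopPart z := hzu.comp _ (T.orderEmbOfFin rfl).injective
  have hprime : 𝔭.IsPrime := hzT.isPrime_span_range
  have h𝔭le : 𝔭 ≤ maximalIdeal R := hzT.span_range_le_maximalIdeal
  -- the regular (hence integrally closed) domain `D = R/𝔭`
  set D := R ⧸ 𝔭 with hD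
  haveI : IsDomain D := Ideal.Quotient.isDomain 𝔭
  haveI : IsRegularLocalRing D := hzT.isRegularLocalRing_quotient
  haveI : IsIntegrallyClosed D := isIntegrallyClosed_of_isRegularLocalRing D
  -- the reduction `ρ : R[X] → D[X]` and the prime `Q = ρ(𝔔)`
  set ρ : R[X] →+* D[X] := mapRingHom (Ideal.Quotient.mk 𝔭) with hρ
  have hρsurj : Function.Surjective ρ := Polynomial.map_surjective _ Ideal.Quotient.mk_surjective
  have hker : RingHom.ker ρ = 𝔭.map (C : R →+* R[X]) := by
    rw [hρ, Polynomial.ker_mapRingHom, Ideal.mk_ker]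
  have h𝔭𝔔 : 𝔭.map (C : R →+* R[X]) ≤ 𝔔 := by rw [Ideal.map_le_iff_le_comap, h𝔔]
  have hker𝔔 : RingHom.ker ρ ≤ 𝔔 := hker ▸ h𝔭𝔔
  set Q : Ideal D[X] := 𝔔.map ρ with hQ
  haveI hQp : Q.IsPrime := Ideal.map_isPrime_of_surjective hρsurj hker𝔔
  have hcomapQ : Q.comap ρ = 𝔔 := by
    rw [hQ, Ideal.comap_map_of_surjective ρ hρsurj, ← RingHom.ker_eq_comap_bot, sup_eq_left.mpr hker𝔔]
  have hQ0 : Q.comap (C : D →+* D[X]) = ⊥ := by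
    refine (Submodule.eq_bot_iff _).mpr fun d hd => ?_
    obtain ⟨d, rfl⟩ := Ideal.Quotient.mk_surjective d
    rw [Ideal.mem_comap, ← Polynomial.map_C (Ideal.Quotient.mk 𝔭), ← Polynomial.coe_mapRingHom, ← hρ, ← Ideal.mem_comap, hcomapQ,
      ← Ideal.mem_comap, h𝔔] at hd
    exact Ideal.Quotient.eq_zero_iff_mem.mpr hd
  -- the reduced equation `g = h mod 𝔭` has multiplicity `m` at `Q`
  set g := h.map (Ideal.Quotient.mk 𝔭) with hg
  have hgmo : g.Monic := hmo.map _
  have hgdeg : g.natDegree = m := hmo.natDegree_map _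
  obtain ⟨s, hs𝔔, hsh⟩ := hord
  have hordQ : ∃ s' ∉ Q, s' * g ∈ Q ^ g.natDegree := by
    refine ⟨ρ s, fun h1 => hs𝔔 (hcomapQ ▸ Ideal.mem_comap.mpr h1), ?_⟩
    rw [hgdeg, hg, ← Polynomial.coe_mapRingHom, ← hρ, ← map_mul, hQ, ← Ideal.map_pow]
    exact Ideal.mem_map_of_mem _ hsh
  obtain ⟨lam, hglam, hQlam⟩ := exists_eq_X_sub_C_pow_of_mul_mem_pow hgmo (hgdeg ▸ hm) Q hQ0 hordQ
  obtain ⟨lam₀, rfl⟩ := Ideal.Quotient.mk_surjective lam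
  -- the coefficients of `h` modulo `𝔭`
  have hcoef𝔭 : ∀ j ∈ Finset.Icc 1 m, h.coeff (m - j) - (m.choose j : R) * (-lam₀) ^ j ∈ 𝔭 := by
    intro j hj
    have hj' := Finset.mem_Icc.mp hj
    rw [← Ideal.Quotient.eq, ← Polynomial.coeff_map, ← hg, hglam, hgdeg, sub_eq_add_neg, ← map_neg, ← map_neg,
      Polynomial.coeff_X_add_C_pow, Nat.choose_symm hj'.2, show m - (m - j) = j by omega, map_mul, map_pow, map_natCast,
      mul_comm]
  -- `λ₀ ∈ 𝔭`: otherwise a solvable vertex of the FULL polyhedron (CP Prop. 2.4 lifting, `…CPFrameFaceVertexAny`)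
  have hlam𝔭 : lam₀ ∈ 𝔭 := by
    have := mem_span_image_of_isMinimal_of_coeff_sub_mem hchar hdim u hu hm hmin T (lam := lam₀) (fun j hj => by
      rw [← hzr]; exact hcoef𝔭 j hj)
    rwa [← hzr] at this
  -- hence `g = X^m`, `Q = (X)`, `𝔔 = 𝔭·R[X] + (X)`
  have hlam0 : Ideal.Quotient.mk 𝔭 lam₀ = 0 := Ideal.Quotient.eq_zero_iff_mem.mpr hlam𝔭
  rw [hlam0, map_zero, sub_zero] at hQlam
  have h𝔔eq : 𝔔 = 𝔭.map (C : R →+* R[X]) ⊔ Ideal.span {X} := by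
    rw [← hcomapQ, hQlam]
    ext q
    rw [Ideal.mem_comap, Ideal.mem_span_singleton, Polynomial.X_dvd_iff, mem_map_C_sup_span_X_iff, hρ, Polynomial.coe_mapRingHom,
      Polynomial.coeff_map, Ideal.Quotient.eq_zero_iff_mem]
  refine ⟨h𝔔eq, ?_⟩
  -- legality, by the `𝔭`-primary calculus
  rw [h𝔔eq] at hs𝔔 hsh
  have hs0 : s.coeff 0 ∉ 𝔭 := fun h0 => hs𝔔 ((mem_map_C_sup_span_X_iff 𝔭 s).mpr h0)
  have hcoefsh : ∀ l, (s * h).coeff l ∈ 𝔭 ^ (m - l) := coeff_mem_pow_of_mem_pow_map_C_sup_span_X 𝔭 hsh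
  have hleg : ∀ b, h.coeff b ∈ 𝔭 ^ (m - b) := by
    intro b
    induction b using Nat.strong_induction_on with
    | _ b ih =>
      have hsum := hcoefsh b
      rw [Polynomial.coeff_mul, ← Finset.add_sum_erase _ _ (Finset.HasAntidiagonal.mem_antidiagonal.mpr (zero_add b) : ((0, b) : ℕ × ℕ) ∈ _)]
        at hsum
      have hrest : ∑ x ∈ (Finset.HasAntidiagonal.antidiagonal b).erase (0, b), s.coeff x.1 * h.coeff x.2 ∈ 𝔭 ^ (m - b) := by
        refine Ideal.sum_mem _ fun x hx => ?_
        obtain ⟨hxne, hx'⟩ := Finset.mem_erase.mp hx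
        have hx'' := Finset.HasAntidiagonal.mem_antidiagonal.mp hx'
        have hlt : x.2 < b := by
          by_contra hge
          apply hxne
          have h2 : x.2 = b := by omega
          have h1 : x.1 = 0 := by omega
          exact Prod.ext h1 h2
        exact Ideal.pow_le_pow_right (by omega) (Ideal.mul_mem_left _ _ (ih x.2 hlt))
      have hmain : s.coeff 0 * h.coeff b ∈ 𝔭 ^ (m - b) := by
        have := Ideal.sub_mem _ hsum hrest
        simpa using this
      have hs0' : s.coeff 0 ∉ Ideal.span (u '' ↑T) := by rwa [← hzr]
      have hmain' : s.coeff 0 * h.coeff b ∈ Ideal.span (u '' ↑T) ^ (m - b) := by rwa [← hzr]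
      have := mem_pow_span_image_rsop_of_mul_mem hd u hu T hs0' (m - b) hmain'
      rwa [← hzr] at this
  intro i hi
  have hi' := Finset.mem_Icc.mp hi
  have := hleg (m - i)
  rwa [show m - (m - i) = i by omega] at this

end Summit.ResolutionOfSingularities.ResolutionOfSingularities.Theorems.SigmaMaxModificationsCorridor3.Helpers

namespace Summit.ResolutionOfSingularities.ResolutionOfSingularities.Theorems.SigmaMaxModificationsCorridor3.Moving

open Summit.ResolutionOfSingularities.ResolutionOfSingularities.Theorems.SigmaMaxModificationsCorridor3.Helpers

/-- [OURS · L1 W4.2] **`hread_menu` in ANY codimension, unconditionally (equicharacteristic stalks)**: a permissible face-centre of an E-adapted CP frame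
with `δ ≥ 1` is read as `V(X, u_T)` LEGALLY. [cite: CossartPiltant2019, Prop. 2.3–2.4, Prop. 2.7 (arXiv v1 pp. 11–14)] [cite: CossartJannsenSaito2020, Def. 3.1, Thm. 3.2 (3)] -/
theorem IsCPFrame.exists_reading_of_face {s : MarkedStage.{0}} {R : Type} [CommRing R] [IsLocalRing R] {u : Fin 3 → R}
    {h : R[X]} {φ : (s.W.presheaf.stalk s.pt : Type) →+* R[X] ⧸ Ideal.span {h}} (hF : IsCPFrame s R u h φ)
    (hchar : ∀ k : ℕ, (k : R) ≠ 0 → IsUnit (k : R))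
    (hco : ∀ i < h.natDegree, h.coeff i ∈ maximalIdeal R ^ (h.natDegree - i))
    (C : s.W.IdealSheafData) (hperm : IdealSheafData.IsPermissibleAt C s.pt) (T : Finset (Fin 3))
    (hT : ∀ t ∈ T, Ideal.Quotient.mk (Ideal.span {h}) (Polynomial.C (u t)) ∈ (stalkIdeal C s.pt).map φ)
    (hdimC : ringKrullDim ((s.W.presheaf.stalk s.pt : Type) ⧸ stalkIdeal C s.pt) + T.card = 3) :
    (stalkIdeal C s.pt).map φ =
        ((Ideal.span (u '' ↑T)).map (Polynomial.C : R →+* R[X]) ⊔ Ideal.span {X}).map (Ideal.Quotient.mk (Ideal.span {h})) ∧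
      ∀ i ∈ Finset.Icc 1 h.natDegree, h.coeff (h.natDegree - i) ∈ Ideal.span (u '' ↑T) ^ i := by
  have hm : 0 < h.natDegree := hF.natDegree_pos
  obtain ⟨𝔔, h𝔔p, h𝔔R, hord, h𝔔B⟩ := hF.exists_prime_of_face hco C hperm T hT hdimC
  obtain ⟨hR, -, hdim, hu, hmon, -, -, -, -, hmin⟩ := hF
  haveI := hR
  obtain ⟨h𝔔eq, hleg⟩ := eq_span_and_coeff_mem_pow_of_isMinimal_any hchar hdim u hu hmon hm hmin T 𝔔 h𝔔R hord
  exact ⟨by rw [h𝔔B, h𝔔eq], hleg⟩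

/-- [OURS · L1 W4.2] **`hread_menu` DISCHARGED in all codimensions**: E-adapted complete minimal CP frames with `δ ≥ 1` along the boundary-threaded
canonical chain, given only the initial frame and the face constraint on the canonical centres at the marked points.
[cite: CossartPiltant2019, Def. 2.6–2.7, Prop. 2.3–2.4, Prop. 2.7 (arXiv v1 pp. 11–14)] [cite: CossartJannsenSaito2020, Def. 3.1, Rem. 6.29 (1)] -/
theorem exists_isCPFrame_adapted_of_reachesσE_of_faces'' {p : ℕ} {R₀ : ∀ S : Scheme.{0}, CentreSeq S → Prop}
    (hRf : OracleFunctional R₀) (hRa : OracleAdmissible R₀) {ν : ℕ → ℕ} {X₀ : Scheme.{0}} [IsLocallyNoetherian X₀] {x : X₀}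
    (hX : IsMaximalOrigin p 3 ν X₀ x) (E₀ : Boundary X₀)
    (hface : ∀ s : MarkedStageE.{0}, ReachesσE (Strategy.cjs R₀).withBoundary 3 ν (MarkedStageE.init X₀ x E₀) s →
      ∀ (C : s.W.IdealSheafData) (P' : Option (Pending (blowup C))), IsCanonicalStep R₀ 3 ν s.L s.P C P' →
      IdealSheafData.IsPermissibleAt C s.pt ∧
      ∃ K : Finset s.W.IdealSheafData, (∀ I ∈ K, I ∈ membersThrough s.E s.pt ∧ stalkIdeal I s.pt ≤ stalkIdeal C s.pt) ∧
        (∀ I ∈ K, ∀ I' ∈ K, stalkIdeal I s.pt = stalkIdeal I' s.pt → I = I') ∧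
        ringKrullDim ((s.W.presheaf.stalk s.pt : Type) ⧸ stalkIdeal C s.pt) + K.card = 3)
    (h0 : ∃ (R : Type) (_ : CommRing R) (_ : IsLocalRing R) (u : Fin 3 → R) (h : R[X])
      (φ : ((MarkedStageE.init X₀ x E₀).W.presheaf.stalk (MarkedStageE.init X₀ x E₀).pt : Type) →+* R[X] ⧸ Ideal.span {h})
      (e : (MarkedStageE.init X₀ x E₀).W.IdealSheafData → Fin 3),
      IsCPFrame (MarkedStageE.init X₀ x E₀).toMarkedStage R u h φ ∧ IsAdicComplete (maximalIdeal R) R ∧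
      (∀ i < h.natDegree, h.coeff i ∈ maximalIdeal R ^ (h.natDegree - i)) ∧
      ∀ I ∈ membersThrough (MarkedStageE.init X₀ x E₀).E (MarkedStageE.init X₀ x E₀).pt,
        (stalkIdeal I (MarkedStageE.init X₀ x E₀).pt).map φ = Ideal.span {Ideal.Quotient.mk _ (Polynomial.C (u (e I)))})
    {s : MarkedStageE.{0}} (hs : ReachesσE (Strategy.cjs R₀).withBoundary 3 ν (MarkedStageE.init X₀ x E₀) s) :
    ∃ (R : Type) (_ : CommRing R) (_ : IsLocalRing R) (u : Fin 3 → R) (h : R[X])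
      (φ : (s.W.presheaf.stalk s.pt : Type) →+* R[X] ⧸ Ideal.span {h}) (e : s.W.IdealSheafData → Fin 3),
      IsCPFrame s.toMarkedStage R u h φ ∧ IsAdicComplete (maximalIdeal R) R ∧
      (∀ i < h.natDegree, h.coeff i ∈ maximalIdeal R ^ (h.natDegree - i)) ∧
      ∀ I ∈ membersThrough s.E s.pt, (stalkIdeal I s.pt).map φ = Ideal.span {Ideal.Quotient.mk _ (Polynomial.C (u (e I)))} := by
  classical
  refine exists_isCPFrame_adapted_of_reachesσE hRf hRa hX E₀ (fun s₁ hs₁ C P' hcs R _ _ u h φ e hF hcpl hco hE => ?_) h0 hs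
  obtain ⟨hperm, K, hK, hKinj, hdimK⟩ := hface s₁ hs₁ C P' hcs
  have hF' := hF
  obtain ⟨hR, hloc, hdim, hu, hmon, hφl, hflat, hmap, -, hmin⟩ := hF'
  haveI := hR
  haveI : IsLocalRing (AdjoinRoot h) := hloc
  letI algφ : Algebra (s₁.W.presheaf.stalk s₁.pt : Type) (R[X] ⧸ Ideal.span {h}) := φ.toAlgebra
  haveI : Module.Flat (s₁.W.presheaf.stalk s₁.pt : Type) (R[X] ⧸ Ideal.span {h}) := hflat
  haveI : IsLocalHom (algebraMap (s₁.W.presheaf.stalk s₁.pt : Type) (R[X] ⧸ Ideal.span {h})) := hφl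
  haveI : Module.FaithfullyFlat (s₁.W.presheaf.stalk s₁.pt : Type) (R[X] ⧸ Ideal.span {h}) := Module.FaithfullyFlat.of_flat_of_isLocalHom
  set T : Finset (Fin 3) := K.image e with hTdef
  have heinj : Set.InjOn e ↑K := by
    intro I hI I' hI' hee
    apply hKinj I (Finset.mem_coe.mp hI) I' (Finset.mem_coe.mp hI')
    have h1 := hE I (hK I (Finset.mem_coe.mp hI)).1
    have h2 := hE I' (hK I' (Finset.mem_coe.mp hI')).1
    rw [← Ideal.comap_map_eq_self_of_faithfullyFlat (B := R[X] ⧸ Ideal.span {h}) (stalkIdeal I s₁.pt),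
      ← Ideal.comap_map_eq_self_of_faithfullyFlat (B := R[X] ⧸ Ideal.span {h}) (stalkIdeal I' s₁.pt)]
    change (Ideal.map φ (stalkIdeal I s₁.pt)).comap φ = (Ideal.map φ (stalkIdeal I' s₁.pt)).comap φ
    rw [h1, h2, hee]
  have hTcard : T.card = K.card := Finset.card_image_of_injOn heinj
  have hT : ∀ t ∈ T, Ideal.Quotient.mk (Ideal.span {h}) (Polynomial.C (u t)) ∈ (stalkIdeal C s₁.pt).map φ := by
    intro t ht
    obtain ⟨I, hIK, rfl⟩ := Finset.mem_image.mp ht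
    have h1 := hE I (hK I hIK).1
    exact Ideal.map_mono (hK I hIK).2 (h1 ▸ Ideal.mem_span_singleton_self _)
  have hdimC : ringKrullDim ((s₁.W.presheaf.stalk s₁.pt : Type) ⧸ stalkIdeal C s₁.pt) + T.card = 3 := by rw [hTcard]; exact hdimK
  exact ⟨T, hF.exists_reading_of_face (hF.natCast_eq_zero_or_isUnit hco (natCast_eq_zero_or_isUnit_stalk_of_reachesσE hX E₀ hs₁))
    hco C hperm T hT hdimC⟩

end Summit.ResolutionOfSingularities.ResolutionOfSingularities.Theorems.SigmaMaxModificationsCorridor3.Moving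

end
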